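import Literature.Computability.Cryptography.CsidhAction
import Literature.NumberTheory.EllipticCurves.CongruentNumberCurveSupersingular
import HarnessLib

/-!
# The CSIDH starting curve `E₀ : y² = x³ + x` is a valid coefficient (`A = 0`)

Topic `Computability/Cryptography`; a proofs-only companion of `CsidhAction.lean` (kept apart
because of its heavier import). CSIDH (Castryck–Lange–Martindale–Panny–Renes 2018), §4: "Fix the
elliptic curve `E₀ : y² = x³ + x` over `𝔽_p`; it is supersingular since `p ≡ 3 (mod 4)`." Here:
for a prime `p ≡ 3 (mod 4)` the Montgomery coefficient `A = 0` is valid, `IsCoeff p 0`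
(`0 ∉ {±2}` and `#E₀(𝔽_p) = p + 1`), by the tree's theorem
`IrelandRosen1990_card_points_three_mod_four` (Ireland–Rosen, Ch. 18 §4 Thm. 5: `y² = x³ - Dx` has
`p + 1` points over `𝔽_p` for `p ≡ 3 (mod 4)`, `p ∤ D`; here `D = -1`). In particular the set
acted on by `cl(ℤ[√-p])` in `csidh_classGroupAction` is non-empty.

## References

* [CastryckEtAl2018] W. Castryck et al., *CSIDH*, ASIACRYPT 2018, §4 (Parameters).
* [IrelandRosen1990] K. Ireland, M. Rosen, *A Classical Introduction to Modern Number Theory*,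
  2nd ed., Ch. 18 §4, Thm. 5.
-/

namespace Literature.Computability.Cryptography.Csidh

/-- **The CSIDH base curve is valid**: for a prime `p ≡ 3 (mod 4)`, `A = 0` is a valid
coefficient, i.e. `E₀ : y² = x³ + x` is smooth and supersingular over `𝔽_p`
(`#E₀(𝔽_p) = p + 1`). CSIDH §4 ("it is supersingular since `p ≡ 3 (mod 4)`"), proved through
Ireland–Rosen Ch. 18 §4 Thm. 5 with `D = -1`. [cite: CastryckEtAl2018, §4 (Parameters)] -/
theorem isCoeff_zero (p : ℕ) [Fact p.Prime] (hp : p % 4 = 3) : IsCoeff p 0 := by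
  have hp2 : p ≠ 2 := by rintro rfl; norm_num at hp
  refine ⟨?_, ?_⟩
  · intro h
    have h4 : ((4 : ℕ) : ZMod p) = 0 := by
      have : (0 : ZMod p) ^ 2 = 0 := by ring
      rw [this] at h
      exact_mod_cast h.symm
    rw [ZMod.natCast_eq_zero_iff] at h4
    have := (Nat.Prime.dvd_mul (Fact.out : p.Prime)).1 (show p ∣ 2 * 2 by simpa using h4)
    rcases this with h | h <;>
      exact hp2 ((Nat.prime_dvd_prime_iff_eq Fact.out Nat.prime_two).1 h)
  · have h := Literature.NumberTheory.EllipticCurves.IrelandRosen1990_card_points_three_mod_four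
      (p := p) hp (D := -1) (by
        rw [Int.dvd_neg, Int.natCast_dvd_ofNat]
        exact fun h1 => (Fact.out : p.Prime).one_lt.ne' (Nat.dvd_one.1 h1))
    have hc : curve p 0 = ⟨0, 0, 0, -((-1 : ℤ) : ZMod p), 0⟩ := by
      simp [curve]
    rw [hc]
    exact h

end Literature.Computability.Cryptography.Csidh
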